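import Mathlib.Topology.Instances.ZMod
import Mathlib.Topology.Algebra.Constructions
import Mathlib.Topology.Algebra.Group.Basic
import Literature.IUT.HodgeTheaters.GlobalFrobenioidsGaloisChartNonVacuityWitness
import Literature.IUT.HodgeTheaters.GlobalFrobenioidsCyclotomes
import Literature.IUT.HodgeTheaters.GlobalFrobenioidsInfKappa
import HarnessLib

/-!
# FACT-LIST (director-abc (C3)(3), tranches 188–190): the [IUTchI] Example 5.1 predicates on the NF-bridge data
# `NFBridgeRecon` — `FlStarPolyAction`, `KappaSolConjugateSynchronization`, `MκIsInvariants`, `ConstantsInfκx`,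
# `InfκxUnitsEqConstants` — and `ModSolReconstruction.RecoversModel` are SCHEMAS: each is EVALUATED AT THE LANDED
# GALOIS MODEL `NFBridgeRecon.galoisModel` (proved-at-model or refuted-at-model) and, in the opposite direction,
# at an explicit structure-update / finite degenerate datum

S. Mochizuki, *Inter-universal Teichmüller theory I*, §5, Example 5.1 (i) pp. 123–125 and (v) pp. 127–129,
kurims manuscript (May 2020) [claim: Mochizuki2012, status: disputed].  PROOF-ONLY companion (no `def`, no
`instance`, no `structure`) of abc-iut-L5-t1's `GlobalFrobenioids.lean` / `GlobalFrobenioidsCyclotomes.lean` /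
`GlobalFrobenioidsInfKappa.lean`.  The frozen FACT-LIST rows F-2571 (`NFBridgeRecon.MκIsInvariants`), F-2572
(`ConstantsInfκx`), F-2573 (`FlStarPolyAction`), F-2574 (`KappaSolConjugateSynchronization`), F-2575
(`InfκxUnitsEqConstants`) and F-2579 (`ModSolReconstruction.RecoversModel`) are `Prop`-valued STRUCTURES over the
INTERFACE DATA `N : NFBridgeRecon` (the objects [AbsTopIII] Thm 1.9 reconstructs from `π₁(†𝒟^⊚)`: `π₁(†𝒟^⊛) ↷ 𝕄̄^⊛`,
`π₁^rat ↷ K_rat ⊇ 𝕄^⊛_∞κ× ⊇ 𝕄^⊛_∞κ ⊇ 𝕄^⊛_κ`, `Aut_ε, Aut^SL_ε ⊆ Aut^SL ⊆ Aut(†𝒟^⊚)` with liftings).  abc-iut-w4-d068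
(gen 3, STATUS 06:20:24Z) left exactly these rows open «until an NF-bridge instance exists»; the instance DOES exist:
abc-iut's `NFBridgeRecon.galoisModel F l` (`GlobalFrobenioidsGaloisChartNonVacuityWitness.lean`) — GENUINE
Galois/constant side `G_F ↷ F̄`, DEGENERATE function-field side (coric sets `:= F̄ ∖ {0}`, `solKer := ⊤`, Aut-data
`PUnit`, liftings `:= id`).  This file records, kernel-checked, for `F := ℚ`:

* F-2573 `FlStarPolyAction`: FAILS at `galoisModel ℚ 5` (`Aut(†𝒟^⊚) := PUnit` has no quotient `≅ 𝔽_5^⋇`,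
  `|𝔽_5^⋇| = 2`) — `not_flStarPolyAction_galoisModel_five`; HOLDS at the structure update carrying the TAUTOLOGICAL
  `𝔽_l^⋇` poly-action `Aut := 𝔽_l^× ⊵ Aut_ε := {±1}`, `Aut^SL := Aut`, `Aut^SL_ε := {±1}` — `exists_flStarPolyAction`.
* F-2574 `KappaSolConjugateSynchronization`: HOLDS at `galoisModel ℚ l` (liftings `= id`) —
  `kappaSolConjugateSynchronization_galoisModel`; FAILS at the finite toy `π₁^rat = π₁(†𝒟^⊛) := ℤ/3` (discrete,
  trivial actions on `ℚ`, `solKer := 1`, lifting `:=` inversion) — `exists_not_kappaSolConjugateSynchronization`.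
* F-2571 `MκIsInvariants`: FAILS at `galoisModel ℚ l` (`√−1 ∈ ℚ̄` is a nonzero "κ-coric" element not fixed by
  `G_ℚ`) — `not_mκIsInvariants_galoisModel`; HOLDS at the update `𝕄^⊛_κ := (𝕄^⊛_∞κ)^{π₁^rat}` — `exists_mκIsInvariants`.
* F-2572 `ConstantsInfκx`, F-2575 `InfκxUnitsEqConstants`: HOLD at `galoisModel ℚ l` (`(F̄ ∖ 0)^× = F̄^×`) —
  `constantsInfκx_galoisModel`, `infκxUnitsEqConstants_galoisModel`; FAIL at the update with EMPTY coric sets —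
  `exists_not_constantsInfκx_not_infκxUnitsEqConstants`.
* F-2579 `ModSolReconstruction.RecoversModel`: FAILS at (`galoisModel ℚ 5`, the degenerate constant-`ℚ` algorithm,
  the one-point pair): the comparison field `𝕄̄^⊛_sol ∪ {0} = ℚ̄^{1} = ℚ̄` contains `√−1`, `ℚ` does not —
  `ModSolReconstruction.exists_not_recoversModel` (the HOLDS direction is abc-iut's landed
  `ModSolReconstruction.exists_recoversModel`, `ModSolReconstructionNonVacuity.lean`).

Consequence for the bookkeeping ONLY: the six rows are SCHEMAS — universal closures REFUTED, instance forms
model-witnessed — consumable at the genuine datum as the named hypotheses of the L5 kernels, never as closed facts.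
HONEST LABELS: `galoisModel` = genuine Galois side / degenerate function-field side; the structure updates and the
`ℤ/3` toy are DEGENERATE data; nothing here is the genuine printed object `π₁(†𝒟^⊚)` of a `𝒟`-ΘNF-Hodge theater and
nothing of [IUTchI] is asserted or denied; refuting a universal closure says NOTHING about print; no side is taken on
[IUTchIII] Cor. 3.12; typed ≠ proved; instantiated ≠ endorsed. [claim: Mochizuki2012, status: disputed]
-/

noncomputable section

namespace Literature.IUT.HodgeTheaters

open Literature.AlgebraicGeometry.Frobenioids

namespace NFBridgeRecon

/-! ### A square root of `−1` in `ℚ̄`: the arithmetic input for the two Galois-model refutations -/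

/-- In `ℚ̄ = AlgebraicClosure ℚ` there is `x` with `x·x = −1`; such an `x` is non-zero and is NOT in the image of
`ℚ` (a rational square is `≥ 0`). [folklore] -/
private theorem exists_sqrt_neg_one :
    ∃ x : QuasiTemperoid.Fbar ℚ, x * x = -1 ∧ x ≠ 0 ∧ x ∉ Set.range (algebraMap ℚ (QuasiTemperoid.Fbar ℚ)) := by
  obtain ⟨x, hx⟩ := IsAlgClosed.exists_eq_mul_self (-1 : QuasiTemperoid.Fbar ℚ)
  refine ⟨x, hx.symm, ?_, ?_⟩
  · intro h0
    rw [h0, mul_zero] at hx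
    exact absurd hx (by norm_num)
  · rintro ⟨q, hq⟩
    have h : algebraMap ℚ (QuasiTemperoid.Fbar ℚ) (q * q) = algebraMap ℚ (QuasiTemperoid.Fbar ℚ) (-1) := by
      rw [map_mul, hq, ← hx, map_neg, map_one]
    have hqq : q * q = -1 := (algebraMap ℚ (QuasiTemperoid.Fbar ℚ)).injective h
    nlinarith [mul_self_nonneg q]

/-! ### F-2573 `FlStarPolyAction` ([IUTchI] Ex 5.1 (i) p.124: `Aut^SL/Aut^SL_ε ⥲ Aut/Aut_ε ⥲ 𝔽_l^⋇`) -/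

/-- **F-2573 REFUTED AT THE GALOIS MODEL** (`l = 5`): `galoisModel ℚ 5` carries the degenerate Aut-data
`Aut(†𝒟^⊚) := PUnit`, `Aut_ε := ⊤`, so `Aut/Aut_ε` is a one-element group, while `𝔽_5^⋇ = 𝔽_5^×/{±1}` has
`l^⋇ = 2` elements (`card_flStar`): there is no isomorphism `Aut/Aut_ε ⥲ 𝔽_5^⋇`, and `FlStarPolyAction` FAILS.
SCHEMA evidence at degenerate Aut-data only. ([IUTchI] Ex 5.1 (i) p.124) [claim: Mochizuki2012, status: disputed] -/
theorem not_flStarPolyAction_galoisModel_five : ¬ (galoisModel ℚ 5).FlStarPolyAction := by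
  intro h
  haveI := h.autε_normal
  obtain ⟨e⟩ := h.quotient_equiv
  change (galoisModel ℚ 5).AutD ⧸ (galoisModel ℚ 5).Autε ≃* FlStar 5 at e
  haveI : Fact (Nat.Prime 5) := ⟨Nat.prime_five⟩
  have hcard : Nat.card (FlStar 5) = 2 := by
    rw [card_flStar 5 (by decide)]
    rfl
  have hnt : Nontrivial (FlStar 5) := Finite.one_lt_card_iff_nontrivial.1 (by omega)
  obtain ⟨a, b, hab⟩ := hnt
  -- the source quotient `PUnit ⧸ ⊤` has one element
  have hsub : ∀ p q : (galoisModel ℚ 5).AutD ⧸ (galoisModel ℚ 5).Autε, p = q := by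
    intro p q
    induction p using QuotientGroup.induction_on with
    | H z =>
      induction q using QuotientGroup.induction_on with
      | H w => rfl
  exact hab (e.symm.injective (hsub _ _))

/-- **F-2573's universal closure is FALSE** (`¬ ∀ N, N.FlStarPolyAction`), by the Galois model at `l = 5`.
([IUTchI] Ex 5.1 (i) p.124) [claim: Mochizuki2012, status: disputed] -/
theorem not_forall_flStarPolyAction : ¬ ∀ N : NFBridgeRecon.{0}, N.FlStarPolyAction :=
  fun h => not_flStarPolyAction_galoisModel_five (h _)

/-- **F-2573 INSTANCE FORM WITNESSED**: replacing the Aut-data of the Galois model by the TAUTOLOGICAL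
`𝔽_l^⋇` poly-action — `Aut(†𝒟^⊚) := 𝔽_l^×`, `Aut_ε := {±1}`, `Aut^SL := 𝔽_l^×`, `Aut^SL_ε := {±1}`, all liftings
`:= id` — gives an `NFBridgeRecon` at which `FlStarPolyAction` HOLDS (`Aut/Aut_ε = 𝔽_l^×/{±1}` IS `𝔽_l^⋇`).
DEGENERATE Aut-data (not the `Aut(†𝒟^⊚)` of a `𝒟`-ΘNF-Hodge theater); SCHEMA evidence only.
([IUTchI] Ex 5.1 (i) p.124) [claim: Mochizuki2012, status: disputed] -/
theorem exists_flStarPolyAction (l : ℕ) : ∃ N : NFBridgeRecon.{0}, N.l = l ∧ N.FlStarPolyAction := by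
  refine ⟨{ galoisModel ℚ l with
            AutD := (ZMod l)ˣ
            autGroup := inferInstance
            Autε := unitsPlusMinus l
            AutSL := ⊤
            AutSLε := unitsPlusMinus l
            autSLε_le := le_top
            autSLε_le_autε := le_rfl
            lift := fun _ => ContinuousMulEquiv.refl _ }, rfl, ?_⟩
  exact
    { autε_normal := inferInstance
      autSLε_normal := inferInstance
      inf_eq := top_inf_eq _
      sup_eq := top_sup_eq _
      quotient_equiv := ⟨MulEquiv.refl _⟩ }

/-! ### F-2574 `KappaSolConjugateSynchronization` ([IUTchI] Ex 5.1 (i) p.125) -/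

/-- **F-2574 PROVED AT THE GALOIS MODEL**: at `galoisModel ℚ l` every chosen lifting of `Aut^SL(†𝒟^⊚)` to
`π₁^rat(†𝒟^⊛)` is the IDENTITY, so all four clauses of κ-sol-conjugate synchronization (liftings preserve
`π₁^{rat/κ-sol}`, agree up to `π₁^{rat/κ-sol}(†𝒟^⊚)`-conjugacy, act trivially on `π₁^{κ-sol}`, are inner on
`π₁^{rat/κ-sol}`) hold with the conjugating element `1`.  Instance form at degenerate liftings; SCHEMA evidence only.
([IUTchI] Ex 5.1 (i) p.125) [claim: Mochizuki2012, status: disputed] -/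
theorem kappaSolConjugateSynchronization_galoisModel (l : ℕ) :
    (galoisModel ℚ l).KappaSolConjugateSynchronization where
  map_ratKsolKer _ _ := Iff.rfl
  indeterminacy _ _ _ := ⟨1, Subgroup.one_mem _, fun g => by
    change g = 1 * g * 1⁻¹
    rw [one_mul, inv_one, mul_one]⟩
  trivial_on_quotient _ g := by
    change g * g⁻¹ ∈ _
    rw [mul_inv_cancel]
    exact Subgroup.one_mem _
  inner_on_kernel _ := ⟨1, Subgroup.one_mem _, fun g _ => by
    change g = 1 * g * 1⁻¹
    rw [one_mul, inv_one, mul_one]⟩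

/-- **F-2574 INSTANCE FORM WITNESSED** (`∃ N, N.KappaSolConjugateSynchronization`), by the Galois model.
([IUTchI] Ex 5.1 (i) p.125) [claim: Mochizuki2012, status: disputed] -/
theorem exists_kappaSolConjugateSynchronization : ∃ N : NFBridgeRecon.{0}, N.KappaSolConjugateSynchronization :=
  ⟨galoisModel ℚ 5, kappaSolConjugateSynchronization_galoisModel 5⟩

/-- **F-2574 REFUTED AT A FINITE TOY**: `π₁^rat(†𝒟^⊛) = π₁(†𝒟^⊛) := ℤ/3` (discrete), acting TRIVIALLY on
`𝕄̄^⊛ := K_rat := ℚ`, coric sets `ℚ ∖ {0}`, `solKer := 1`, Aut-data `PUnit` with the lifting `:=` INVERSION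
`g ↦ g⁻¹`.  Then `π₁^{rat/κ-sol} = (kernel of the action) ∩ solKer = 1`, and the clause "trivial on the quotient
`π₁^{κ-sol}`" demands `g⁻¹·g⁻¹ = 1` for the generator `g` of `ℤ/3` — false.  DEGENERATE datum; SCHEMA evidence
only. ([IUTchI] Ex 5.1 (i) p.125) [claim: Mochizuki2012, status: disputed] -/
theorem exists_not_kappaSolConjugateSynchronization :
    ∃ N : NFBridgeRecon.{0}, ¬ N.KappaSolConjugateSynchronization := by
  have hne : (Multiplicative.ofAdd (1 : ZMod 3))⁻¹ * (Multiplicative.ofAdd (1 : ZMod 3))⁻¹ ≠ 1 := by decide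
  let T := Multiplicative (ZMod 3)
  let G : ProfiniteGrp.{0} := ProfiniteGrp.of T
  letI act : MulSemiringAction G ℚ := MulSemiringAction.compHom ℚ (1 : G →* RingAut ℚ)
  have hsmul : ∀ (g : G) (f : ℚ), g • f = f := fun _ _ => rfl
  let ι : G ≃ₜ* G :=
    { MulEquiv.inv T with
      continuous_toFun := continuous_of_discreteTopology
      continuous_invFun := continuous_of_discreteTopology }
  let N : NFBridgeRecon.{0} :=
    { l := 5
      piDast := G
      piDcirc := ⊤
      Fbar := ℚ
      fbarField := inferInstance
      fbarAction := act
      isOpen_stabilizer_fbar := fun _ => isOpen_discrete _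
      piRat := G
      ratToAst := ContinuousMonoidHom.id G
      ratToAst_surjective := Function.surjective_id
      Krat := ℚ
      kratField := inferInstance
      kratAction := act
      isOpen_stabilizer_krat := fun _ => isOpen_discrete _
      const := RingHom.id ℚ
      const_smul := fun _ _ => rfl
      Mκ := {f | f ≠ 0}
      Minfκ := {f | f ≠ 0}
      Minfκx := {f | f ≠ 0}
      mκ_subset := subset_rfl
      minfκ_subset := subset_rfl
      zero_notMem := fun h => h rfl
      smul_mem_minfκ := fun g f hf => by
        change g • f ≠ 0
        rw [hsmul]
        exact hf
      smul_mem_minfκx := fun g f hf => by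
        change g • f ≠ 0
        rw [hsmul]
        exact hf
      solKer := ⊥
      solKer_normal := inferInstance
      AutD := PUnit
      autGroup := inferInstance
      Autε := ⊤
      AutSL := ⊤
      AutSLε := ⊤
      autSLε_le := le_rfl
      autSLε_le_autε := le_rfl
      lift := fun _ => ι }
  refine ⟨N, fun h => ?_⟩
  let g : T := Multiplicative.ofAdd 1
  have hmem := h.trivial_on_quotient 1 g
  -- `π₁^{rat/κ-sol} = actionKer ⊓ comap id ⊥ ≤ ⊥`
  have hbot : (N.lift 1 g) * g⁻¹ ∈ (⊥ : Subgroup T) := by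
    have h2 := (Subgroup.mem_inf.1 hmem).2
    rw [Subgroup.mem_comap] at h2
    exact h2
  have hval : (N.lift 1 g) = g⁻¹ := rfl
  rw [hval, Subgroup.mem_bot] at hbot
  exact hne hbot

/-- **F-2574's universal closure is FALSE** (`¬ ∀ N, N.KappaSolConjugateSynchronization`).
([IUTchI] Ex 5.1 (i) p.125) [claim: Mochizuki2012, status: disputed] -/
theorem not_forall_kappaSolConjugateSynchronization :
    ¬ ∀ N : NFBridgeRecon.{0}, N.KappaSolConjugateSynchronization := fun h =>
  let ⟨N, hN⟩ := exists_not_kappaSolConjugateSynchronization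
  hN (h N)

/-! ### F-2571 `MκIsInvariants` ([IUTchI] Ex 5.1 (i) p.124: `𝕄^⊛_κ` = the `π₁^rat`-invariants of `𝕄^⊛_∞κ`) -/

/-- **F-2571 REFUTED AT THE GALOIS MODEL**: at `galoisModel ℚ l` all three coric sets are `ℚ̄ ∖ {0}` and `π₁^rat = G_ℚ`
acts on `K_rat := ℚ̄` tautologically; `√−1 ∈ ℚ̄ ∖ {0}` lies in `𝕄^⊛_κ` but is NOT `G_ℚ`-invariant (the
`π₁(†𝒟^⊛)`-invariants of the model are exactly `ℚ`, `mem_mbarMod_galoisModel_iff`), so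
`𝕄^⊛_κ ≠ (𝕄^⊛_∞κ)^{π₁^rat}` and `MκIsInvariants` FAILS.  SCHEMA evidence (degenerate function-field side) only.
([IUTchI] Ex 5.1 (i) p.124) [claim: Mochizuki2012, status: disputed] -/
theorem not_mκIsInvariants_galoisModel (l : ℕ) : ¬ (galoisModel ℚ l).MκIsInvariants := by
  rintro ⟨h⟩
  obtain ⟨x, -, hx0, hxQ⟩ := exists_sqrt_neg_one
  have hxM : (show (galoisModel ℚ l).Krat from x) ∈ (galoisModel ℚ l).Mκ := hx0
  rw [h] at hxM
  obtain ⟨-, hfix⟩ := hxM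
  have hxmod : (show (galoisModel ℚ l).Fbar from x) ∈ (galoisModel ℚ l).MbarMod := fun m => hfix m
  rw [mem_mbarMod_galoisModel_iff, IntermediateField.mem_bot] at hxmod
  exact hxQ hxmod

/-- **F-2571's universal closure is FALSE** (`¬ ∀ N, N.MκIsInvariants`). ([IUTchI] Ex 5.1 (i) p.124)
[claim: Mochizuki2012, status: disputed] -/
theorem not_forall_mκIsInvariants : ¬ ∀ N : NFBridgeRecon.{0}, N.MκIsInvariants :=
  fun h => not_mκIsInvariants_galoisModel 5 (h _)

/-- **F-2571 INSTANCE FORM WITNESSED**: updating the Galois model by `𝕄^⊛_κ :=` the `π₁^rat`-invariants of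
`𝕄^⊛_∞κ = ℚ̄ ∖ {0}` [at the model: the non-zero RATIONALS] gives an `NFBridgeRecon` at which `MκIsInvariants` HOLDS —
this is print's own definition of `𝕄^⊛_κ` read as a recipe.  Degenerate function-field side; SCHEMA evidence only.
([IUTchI] Ex 5.1 (i) p.124) [claim: Mochizuki2012, status: disputed] -/
theorem exists_mκIsInvariants (l : ℕ) : ∃ N : NFBridgeRecon.{0}, N.l = l ∧ N.MκIsInvariants := by
  refine ⟨{ galoisModel ℚ l with
            Mκ := {f | f ∈ (galoisModel ℚ l).Minfκ ∧ ∀ g : (galoisModel ℚ l).piRat, g • f = f}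
            mκ_subset := fun _ hf => hf.1 }, rfl, ⟨rfl⟩⟩

/-! ### F-2572 `ConstantsInfκx` and F-2575 `InfκxUnitsEqConstants` ([IUTchI] Ex 5.1 (i) p.124 / (v) p.128) -/

/-- **F-2572 PROVED AT THE GALOIS MODEL**: at `galoisModel ℚ l` the constants map is the identity of `ℚ̄` and
`𝕄^⊛_∞κ× = ℚ̄ ∖ {0}`, so every non-zero constant is ∞κ×-coric.  Instance form; SCHEMA evidence only.
([IUTchI] Ex 5.1 (i) p.124) [claim: Mochizuki2012, status: disputed] -/
theorem constantsInfκx_galoisModel (l : ℕ) : (galoisModel ℚ l).ConstantsInfκx :=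
  ⟨fun x => x.ne_zero⟩

/-- **F-2575 PROVED AT THE GALOIS MODEL**: at `galoisModel ℚ l`, `(𝕄^⊛_∞κ×)^× = {f ∈ ℚ̄ | 1, f, f⁻¹ ≠ 0} = ℚ̄^×` is
exactly the image of the non-zero constants `𝕄^⊛ = ℚ̄^×` under the (identity) constants map.  Instance form;
SCHEMA evidence only. ([IUTchI] Ex 5.1 (v) p.128) [claim: Mochizuki2012, status: disputed] -/
theorem infκxUnitsEqConstants_galoisModel (l : ℕ) : (galoisModel ℚ l).InfκxUnitsEqConstants := by
  refine ⟨Set.ext fun f => ⟨fun hf => ?_, ?_⟩⟩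
  · obtain ⟨-, hf0, -⟩ := hf
    exact ⟨Units.mk0 (show QuasiTemperoid.Fbar ℚ from f) hf0, rfl⟩
  · rintro ⟨u, rfl⟩
    exact ⟨(one_ne_zero : (1 : QuasiTemperoid.Fbar ℚ) ≠ 0), u.ne_zero, inv_ne_zero u.ne_zero⟩

/-- **F-2572 and F-2575 INSTANCE FORMS WITNESSED** (`∃ N, …`), by the Galois model.
([IUTchI] Ex 5.1 (i) p.124, (v) p.128) [claim: Mochizuki2012, status: disputed] -/
theorem exists_constantsInfκx_infκxUnitsEqConstants :
    ∃ N : NFBridgeRecon.{0}, N.ConstantsInfκx ∧ N.InfκxUnitsEqConstants :=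
  ⟨galoisModel ℚ 5, constantsInfκx_galoisModel 5, infκxUnitsEqConstants_galoisModel 5⟩

/-- **F-2572 and F-2575 REFUTED AT A DEGENERATE UPDATE**: the Galois model with all three coric sets EMPTY is an
`NFBridgeRecon` (the closure conditions are vacuous) at which the constant `1` is not ∞κ×-coric and
`(𝕄^⊛_∞κ×)^× = ∅ ≠` the (non-empty) image of the constants: `ConstantsInfκx` and `InfκxUnitsEqConstants` both
FAIL.  DEGENERATE datum; SCHEMA evidence only. ([IUTchI] Ex 5.1 (i) p.124, (v) p.128)
[claim: Mochizuki2012, status: disputed] -/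
theorem exists_not_constantsInfκx_not_infκxUnitsEqConstants :
    ∃ N : NFBridgeRecon.{0}, ¬ N.ConstantsInfκx ∧ ¬ N.InfκxUnitsEqConstants := by
  refine ⟨{ galoisModel ℚ 5 with
            Mκ := ∅
            Minfκ := ∅
            Minfκx := ∅
            mκ_subset := subset_rfl
            minfκ_subset := subset_rfl
            zero_notMem := fun h => h
            smul_mem_minfκ := fun _ _ h => h.elim
            smul_mem_minfκx := fun _ _ h => h.elim }, ?_, ?_⟩
  · rintro ⟨h⟩
    exact h 1
  · rintro ⟨h⟩
    have h1 : ((1 : (QuasiTemperoid.Fbar ℚ)ˣ) : QuasiTemperoid.Fbar ℚ) ∈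
        Set.range fun x : (QuasiTemperoid.Fbar ℚ)ˣ => (x : QuasiTemperoid.Fbar ℚ) := ⟨1, rfl⟩
    have h1' := h.symm ▸ h1
    exact h1'.1

/-- **F-2572's universal closure is FALSE** (`¬ ∀ N, N.ConstantsInfκx`). ([IUTchI] Ex 5.1 (i) p.124)
[claim: Mochizuki2012, status: disputed] -/
theorem not_forall_constantsInfκx : ¬ ∀ N : NFBridgeRecon.{0}, N.ConstantsInfκx := fun h =>
  let ⟨N, hN, _⟩ := exists_not_constantsInfκx_not_infκxUnitsEqConstants
  hN (h N)

/-- **F-2575's universal closure is FALSE** (`¬ ∀ N, N.InfκxUnitsEqConstants`). ([IUTchI] Ex 5.1 (v) p.128)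
[claim: Mochizuki2012, status: disputed] -/
theorem not_forall_infκxUnitsEqConstants : ¬ ∀ N : NFBridgeRecon.{0}, N.InfκxUnitsEqConstants := fun h =>
  let ⟨N, _, hN⟩ := exists_not_constantsInfκx_not_infκxUnitsEqConstants
  hN (h N)

end NFBridgeRecon

/-! ### F-2579 `ModSolReconstruction.RecoversModel` ([IUTchI] Ex 5.1 (v) p.129) -/

namespace ModSolReconstruction

/-- **F-2579 REFUTED**: at the Galois model `galoisModel ℚ 5` the comparison field of `RecoversModel` — the fixed
field in `𝕄̄^⊛ = ℚ̄` of the image of `π₁^{rat/κ-sol}` — is all of `ℚ̄` (`π₁^{rat/κ-sol} ⊆` the kernel of the action on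
`𝕄^⊛_∞κ = ℚ̄ ∖ {0}`, which fixes `√−1`), so it contains a square root of `−1`; the DEGENERATE algorithm returning the
constant field `ℚ` (trivial action, `Kmod := ⊤`) at the one-point input pair therefore does NOT recover the model:
no ring isomorphism `ℚ ≅ 𝕄̄^⊛_sol ∪ {0}`.  Together with the landed witness `exists_recoversModel`
(`ModSolReconstructionNonVacuity.lean`) the row is a SCHEMA.  DEGENERATE algorithm/pair; SCHEMA evidence only.
([IUTchI] Ex 5.1 (v) p.129) [claim: Mochizuki2012, status: disputed] -/
theorem exists_not_recoversModel :
    ∃ (N : NFBridgeRecon.{0}) (A : ModSolReconstruction N.piRat) (model : CoricPair N.piRat),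
      ¬ A.RecoversModel N model := by
  let N := NFBridgeRecon.galoisModel ℚ 5
  letI actQ : MulSemiringAction N.piRat ℚ := MulSemiringAction.compHom ℚ (1 : N.piRat →* RingAut ℚ)
  let A : ModSolReconstruction N.piRat :=
    { K := fun _ => ℚ
      Kmod := fun _ => ⊤
      map := fun _ => RingEquiv.refl _
      map_smul := fun _ _ _ => rfl
      map_mem := fun _ _ => Iff.rfl }
  letI actU : MulAction N.piRat PUnit :=
    { smul := fun _ _ => PUnit.unit
      one_smul := fun _ => rfl
      mul_smul := fun _ _ _ => rfl }
  let model : CoricPair N.piRat :=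
    { carrier := PUnit
      pm := ⟨Set.univ, fun _ => PUnit.unit⟩
      action := actU
      isOpen_stabilizer := fun x => by
        have hst : (MulAction.stabilizer N.piRat x : Set N.piRat) = Set.univ :=
          Set.eq_univ_of_forall fun _ => rfl
        rw [hst]
        exact isOpen_univ
      smul_dom := fun _ _ => Iff.rfl
      smul_op := fun _ _ => rfl }
  refine ⟨N, A, model, ?_⟩
  rintro ⟨φ, -, -⟩
  obtain ⟨x, hx, hx0, -⟩ := NFBridgeRecon.exists_sqrt_neg_one
  -- `√−1` lies in the comparison field
  have hxS : (show N.Fbar from x) ∈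
      FixedPoints.subfield (N.ratKsolKer.map N.ratToAst.toMonoidHom) N.Fbar := by
    change ∀ m : ↥(N.ratKsolKer.map N.ratToAst.toMonoidHom), m • (show N.Fbar from x) = x
    rintro ⟨m, hm⟩
    obtain ⟨g, hg, rfl⟩ := Subgroup.mem_map.1 hm
    have hact := (Subgroup.mem_inf.1 hg).1
    exact hact x hx0
  let y : ℚ := φ.symm ⟨x, hxS⟩
  have hy : φ (y * y) = φ (-1) := by
    rw [map_mul, map_neg, map_one]
    change φ (φ.symm ⟨x, hxS⟩) * φ (φ.symm ⟨x, hxS⟩) = -1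
    rw [RingEquiv.apply_symm_apply]
    exact Subtype.ext hx
  have hyy : y * y = -1 := φ.injective hy
  nlinarith [mul_self_nonneg y]

/-- **F-2579's universal closure is FALSE** (`¬ ∀ N A model, A.RecoversModel N model`).
([IUTchI] Ex 5.1 (v) p.129) [claim: Mochizuki2012, status: disputed] -/
theorem not_forall_recoversModel :
    ¬ ∀ (N : NFBridgeRecon.{0}) (A : ModSolReconstruction N.piRat) (model : CoricPair N.piRat),
      A.RecoversModel N model := fun h =>
  let ⟨N, A, model, hN⟩ := exists_not_recoversModel
  hN (h N A model)

end ModSolReconstruction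

end Literature.IUT.HodgeTheaters

end
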